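import Summits.Schanuel.Schanuel.Theorems.RootDecomp1KArcCell12

/-!
# RootDecomp1KArcCell — lens 1, generation 50, node 9 «THE ARC ENGINE: separation by positive-dimensional containment; members ρ° = Π(1+4^(−k!)) and the twin σ° = Π(1+2·4^(−k!)); item 33364 decided hyp-free at zA = (1, ℓ₂, ρ°), zD = (1, ρ°, σ°) and π-twins» — continuation (RootDecomp1KArcCell13): §12a part 2 the form lower bound at zD, the 33364 instances, zD_shape

(lens-1 g50 HOME kernel K = HOME/decomp-schanuel-lens-1/g50/ArcCell.lean 10f1e0d5…, 3410 l · 258 decl lines, imports …RootDecomp1KCollarWall05 + …RootDecomp1KCommonRadixCell04 + …RootDecomp1KNWMeasureHolds BY NAME; P ArcCellProbe.lean af7624ff… rc 0 / C₀ ArcCellCtrl0.lean d71f613e… rc 0 / C ArcCellCtrl.lean 242a3b02… rc 1 = 42 planted; memo NODE-g50.md; CLAIM L2466, EX-ANTE PRICE + CHECKLIST K-g50 L2467, NODE L2469 / REQUEST L2470 (with the lens's ex-post self-correction: both members fall to printed dominance in substance — zA directly by Bundschuh LNM 1415 p.78 / Zhu 推论 1.3.3, zD after τ = σ°/ρ°²);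 critic VERDICT L2473: CLEARED AS PRICED EX ANTE — ONE CELL ×1 «ARC CELL (TYPED-LEVEL)» with the SUBSTANCE CAVEAT OF RECORD (both members inside the archimedean dominance class in substance; E2 convenient, not necessary), RULE K-R39 FIXED, PORT GO. Port by census-1 gen 21 as `RootDecomp1KArcCell01–13` along K's §1–§12 with §4, §7 and §12 cut at decl boundaries by the 400-line file cap: 01 = §1 (E1) `aeval_one_div_two_pow_ne_zero` (dyadic root lemma) + §2 (E2) `toPolyPoly`, `arc_count` (a relation contains ≤ deg q of an injective family of rational arcs — roots over the domain ℚ[X]); 02 = §3 (A) the member: `dfac`, `arcNum`, `arcProdQ` (ρ°_N), `sQ`, `rhoArc` (ρ° = Π(1 + 4^(−k!))) and its tails; 03 = §4a (E3) `TruncGenericSeq` («[class] definition» tag) + **`algebraicIndependent_of_truncGenericSeq`** (the g36/g37 extraction re-plumbed to arbitrary dyadic-type schedules); 04 = §4b `psQ`, the link `truncGeneric_iff_truncGenericSeq` and the tree (X′) re-derived — K's `theorem algebraicIndependent_liouville_of_truncGeneric'` DEMOTED to a documented `example` (its statement is byte-identical to the tree's `RootDecomp1KCommonRadixCell.algebraicIndependent_liouville_of_truncGeneric`,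 CommonRadixCell03 l.98 — dedup twin flagged by the writer L2472 (α), demotion pre-sanctioned by the critic L2473; nothing in K uses the primed name); 05 = §5 the arcs of ρ°: `arcPoly`, `arcF`, `arcBasis`, `arcScal`, `clearArc`, `truncGenericSeq_arc`, tightness `qArc` / `qArc_tight`; 06 = §6 the arc cell `algebraicIndependent_arc_of_mvPolyMeasure`, `algebraicIndependent_rhoArc_ell2`, walls `sb_arcWall3(_pi)`, item-shape instances + §7 head `zA` / `zApi`, `linearIndependent_zA(pi)`, `linLiouville_zA(pi)`; 07 = §7a the ONE 2-adic cut `cutA` + **`form_lower_bound_A`** (exponent 9), `not_hyperLinLiouville_zA(pi)` (m₀ = 10), `sb_zA(pi)`, `finiteOrderLiouvilleSchanuel_at_zA(pi)`, `item33364_at_zA(pi)`, `item31077_at_zA`; 08 = §8 `rhoArc_position` (11 conjuncts by tree name) and its lemmas, `liouville_rhoArc`; 09 = §9 (A′) the twin σ° = Π(1 + 2·4^(−k!)): `arcNum2`, `arcOdd2`, `arcProdQ2`, `sigmaArc`, `liouville_sigmaArc`; 10 = §10 the lines of (ρ°, σ°): `linPoly`, `linF`, `linBasis`, `linScal`, `clearLin`,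 `truncGenericSeq_lin`, `qLin` / `qLin_tight`; 11 = §11 the twin cell `algebraicIndependent_twin_of_mvPolyMeasure`, walls `sb_twinWall3(_pi)`, item-shape instances + §12 head `zD` / `zDpi`, binders; 12 = §12a part 1 the archimedean two-level cut `cutD`, `cutD_succ_ne_zero`, `cutD_height_bound`; 13 = §12a part 2 **`form_lower_bound_D`** (exponent 7), `not_hyperLinLiouville_zD(pi)` (m₀ = 8), `sb_zD(pi)`, `item33364_at_zD(pi)`, `zD_shape`. PORT EDITS (census convention): `set_option linter.dupNamespace false` dropped; 77 one-line helper docstrings added (statements quoted); per-part private helper copies; sections `Extraction` / `Members` / `TwinMembers` closed and re-opened across the cuts with their `variable` / `open` lines; statements and proofs otherwise verbatim (no renames; K's own private markers kept). `--supports stmt-Schanuel-33364`; no census credit carried; rung 0 — nothing here proves Schanuel; no ∀-item moves; 33364, 33363, 31077 stay OPEN.)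
-/

noncomputable section

open Polynomial LiouvilleNumber
open scoped Nat

namespace Summit.Schanuel.Schanuel.Theorems.RootDecomp1KArcCell

open Summit.Schanuel.Schanuel.Theorems.RootDecomp1KCollarCell
open Summit.Schanuel.Schanuel.Theorems.RootDecomp1KGapCell
open Summit.Schanuel.Schanuel.Theorems.RootDecomp1KTwoBaseCell
open Summit.Schanuel.Schanuel.Theorems.RootDecomp1KRelLiouvilleCell
open Summit.Schanuel.Schanuel.Theorems.RootDecomp1KNWMeasureHolds (polyMeasure_exp_one_holds)
open Summit.Schanuel.Schanuel.Theorems.RootDecomp1KHyper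
open Summit.Schanuel.Schanuel.Theorems.RootDecomp1KHyper.HyperCell
open Summit.Schanuel.Schanuel.Theorems.RootDecomp1KCommonRadixCell (TruncGeneric algebraicIndependent_liouville_of_truncGeneric)

section TwinMembers

open IntermediateField

/-- **(M′) THE TWO-LEVEL ARCHIMEDEAN FORM BOUND** at the twin member: for every integer vector `g ≠ 0`,
`exp(−(1+Σ|gᵢ|)^7) ≤ |g₀ + g₁ρ° + g₂σ°|`.  With `H = Σ|gᵢ|` and `N` the LEAST level `≥ 3` with `H < 2^{N!}`, cut at level `N+1`
(resolution `4^{D_{N+1}} = 2^{2D_{N+1}}`): the cut integer is NON-ZERO (`cutD_succ_ne_zero`), the truncation error is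
`≤ 44H/4^{(N+2)!} ≤ ½·2^{−2D_{N+1}}` (`cutD_slack`), and minimality gives `2D_{N+1} + 2 ≤ (1+H)^7` (`cutD_height_bound`). -/
theorem form_lower_bound_D (g : Fin 3 → ℤ) (hg : g ≠ 0) :
    Real.exp (-((1 + ∑ i, (|g i| : ℝ)) ^ 7)) ≤
      |(g 0 : ℝ) + g 1 * rhoArc + g 2 * sigmaArc| := by
  classical
  set HR : ℝ := ∑ i, (|g i| : ℝ) with hHR
  set Hn : ℕ := ∑ i, (g i).natAbs with hHn
  have hHRn : HR = (Hn : ℝ) := by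
    rw [hHR, hHn, Nat.cast_sum]
    refine Finset.sum_congr rfl fun i _ => ?_
    simp only [Nat.cast_natAbs, Int.cast_abs]
  have hgi : ∀ i, (g i).natAbs ≤ Hn := fun i =>
    Finset.single_le_sum (f := fun i => (g i).natAbs) (fun _ _ => Nat.zero_le _) (Finset.mem_univ i)
  have hHn1 : 1 ≤ Hn := by
    obtain ⟨i, hi⟩ := Function.ne_iff.mp hg
    have hi' : g i ≠ 0 := by simpa using hi
    exact le_trans (Nat.one_le_iff_ne_zero.mpr (Int.natAbs_ne_zero.mpr hi')) (hgi i)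
  -- the cut level: `N` least with `3 ≤ N ∧ Hn < 2^{N!}`; the cut is taken at level `N + 1`
  have hex : ∃ N : ℕ, 3 ≤ N ∧ Hn < 2 ^ N ! := by
    refine ⟨max 3 Hn, le_max_left _ _, Nat.lt_two_pow_self.trans_le (Nat.pow_le_pow_right (by norm_num) ?_)⟩
    exact (le_max_right 3 Hn).trans (Nat.self_le_factorial _)
  set N : ℕ := Nat.find hex with hN
  have hNspec : 3 ≤ N ∧ Hn < 2 ^ N ! := Nat.find_spec hex
  have hNmin : ∀ k < N, 3 ≤ k → 2 ^ k ! ≤ Hn := fun k hk hk3 => by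
    have h1 : ¬ (3 ≤ k ∧ Hn < 2 ^ k !) := Nat.find_min hex hk
    rw [not_and, not_lt] at h1
    exact h1 hk3
  have hN3 : 3 ≤ N := hNspec.1
  set F : ℕ := 2 * dfac (N + 1) with hF
  have hsmall : ∀ i, |g i| < 2 ^ N ! := fun i => by
    have h1 : (((g i).natAbs : ℕ) : ℤ) < 2 ^ N ! := by exact_mod_cast (hgi i).trans_lt hNspec.2
    rwa [Int.natCast_natAbs] at h1
  have hI : cutD g (N + 1) ≠ 0 := cutD_succ_ne_zero g hN3 hg (hsmall 1) (hsmall 2)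
  have hlow := cutD_lower g (N + 1) hI
  have happ := cutD_approx g (N + 1)
  -- the truncation error is at most half the resolution
  have hs : 7 + N ! + F ≤ 2 * (N + 1 + 1)! := cutD_slack (by omega)
  have hgiR : ∀ i, |(g i : ℝ)| ≤ (Hn : ℝ) := fun i => by
    have h1 : (((g i).natAbs : ℕ) : ℝ) ≤ Hn := by exact_mod_cast hgi i
    rwa [Nat.cast_natAbs, Int.cast_abs] at h1
  have hHnR : (Hn : ℝ) ≤ (2 : ℝ) ^ N ! := by exact_mod_cast hNspec.2.le
  have h4pow : (4 : ℝ) ^ (N + 1 + 1)! = 2 ^ (2 * (N + 1 + 1)!) := by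
    rw [pow_mul]; norm_num
  have heps : |(g 1 : ℝ)| * (8 / (4 : ℝ) ^ (N + 1 + 1)!) + |(g 2 : ℝ)| * (36 / (4 : ℝ) ^ (N + 1 + 1)!) ≤
      1 / (2 : ℝ) ^ F / 2 := by
    rw [h4pow]
    have b1 : (1 : ℝ) / 2 ^ (2 * (N + 1 + 1)!) ≤ 1 / 2 ^ (7 + N ! + F) :=
      one_div_le_one_div_of_le (by positivity) (pow_le_pow_right₀ (by norm_num) hs)
    have hsplit : (2 : ℝ) ^ (7 + N ! + F) = 128 * 2 ^ N ! * 2 ^ F := by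
      rw [pow_add, pow_add]; norm_num
    calc |(g 1 : ℝ)| * (8 / (2 : ℝ) ^ (2 * (N + 1 + 1)!)) + |(g 2 : ℝ)| * (36 / (2 : ℝ) ^ (2 * (N + 1 + 1)!))
        = (8 * |(g 1 : ℝ)| + 36 * |(g 2 : ℝ)|) * (1 / 2 ^ (2 * (N + 1 + 1)!)) := by ring
      _ ≤ (8 * (Hn : ℝ) + 36 * Hn) * (1 / 2 ^ (7 + N ! + F)) := by
          gcongr
          · exact hgiR 1
          · exact hgiR 2
      _ = (Hn : ℝ) * 44 / (128 * 2 ^ N ! * 2 ^ F) := by rw [← hsplit]; ring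
      _ ≤ 2 ^ N ! * 44 / (128 * 2 ^ N ! * 2 ^ F) := by gcongr
      _ ≤ 2 ^ N ! * 64 / (128 * 2 ^ N ! * 2 ^ F) := by gcongr; norm_num
      _ = 1 / (2 : ℝ) ^ F / 2 := by field_simp; ring
  set frm : ℝ := (g 0 : ℝ) + g 1 * rhoArc + g 2 * sigmaArc with hfrm
  set Φ : ℝ := (g 0 : ℝ) + g 1 * ((arcProdQ (N + 1) : ℚ) : ℝ) + g 2 * ((arcProdQ2 (N + 1) : ℚ) : ℝ) with hΦ
  have hfrm_low : 1 / (2 : ℝ) ^ F / 2 ≤ |frm| := by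
    have h1 : |Φ| - |frm - Φ| ≤ |frm| := by
      have := abs_sub_abs_le_abs_sub Φ frm
      rw [abs_sub_comm Φ frm] at this
      linarith
    linarith [hlow, happ.trans heps]
  have h7 : F + 2 ≤ (1 + Hn) ^ 7 := cutD_height_bound hHn1 hN3 hNmin
  have hgoal : Real.exp (-((1 + HR) ^ 7)) ≤ 1 / (2 : ℝ) ^ F / 2 := by
    have hE : ((F : ℝ) + 1) ≤ (1 + HR) ^ 7 := by
      rw [hHRn]
      have : ((F + 2 : ℕ) : ℝ) ≤ (((1 + Hn) ^ 7 : ℕ) : ℝ) := by exact_mod_cast h7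
      push_cast at this
      linarith
    have hlog2 : Real.log 2 ≤ 1 := by have := Real.log_two_lt_d9; linarith
    have e1 : 1 / (2 : ℝ) ^ F / 2 = Real.exp (-(((F + 1 : ℕ) : ℝ) * Real.log 2)) := by
      rw [Real.exp_neg, Real.exp_nat_mul, Real.exp_log two_pos, pow_succ]
      field_simp
    rw [e1, Real.exp_le_exp, neg_le_neg_iff]
    push_cast
    calc ((F : ℝ) + 1) * Real.log 2 ≤ ((F : ℝ) + 1) * 1 := mul_le_mul_of_nonneg_left hlog2 (by positivity)
      _ ≤ (1 + HR) ^ 7 := by rw [mul_one]; exact hE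
  exact hgoal.trans hfrm_low

/-- **(iii) `zD` has NO hyper-small integer forms** — refuted AT `m₀ = 8` from (M′) at exponent `7` — HYPOTHESIS-FREE. -/
theorem not_hyperLinLiouville_zD : ¬ HyperLinLiouville zD := by
  intro hH
  obtain ⟨g, hg, hlt⟩ := hH 8
  rw [norm_zD_form] at hlt
  have hlow := form_lower_bound_D g hg
  have hX : (1 : ℝ) ≤ 1 + ∑ i, (|g i| : ℝ) := by
    have : (0 : ℝ) ≤ ∑ i, (|g i| : ℝ) :=
      Finset.sum_nonneg fun i _ => by exact_mod_cast abs_nonneg (g i)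
    linarith
  have hmono : (1 + ∑ i, (|g i| : ℝ)) ^ 7 ≤ (1 + ∑ i, (|g i| : ℝ)) ^ 8 :=
    pow_le_pow_right₀ hX (by norm_num)
  have := Real.exp_le_exp.mpr (neg_le_neg hmono)
  linarith

/-- The exponent control at `zD`: at `m = 7` itself what (M′) gives is exactly the non-strict opposite inequality. -/
theorem no_hyperSmall_form_at_seven (g : Fin 3 → ℤ) (hg : g ≠ 0) :
    ¬ ‖∑ i, (g i : ℂ) * zD i‖ < Real.exp (-((1 + ∑ i, (|g i| : ℝ)) ^ 7)) := by
  rw [norm_zD_form, not_lt]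
  exact form_lower_bound_D g hg

/-- **(iii^π) `zD^π` has NO hyper-small integer forms** (refuted at `m = 8`; `π ≥ 1`) — HYPOTHESIS-FREE. -/
theorem not_hyperLinLiouville_zDpi : ¬ HyperLinLiouville zDpi := by
  intro hH
  obtain ⟨g, hg, hlt⟩ := hH 8
  rw [norm_zDpi_form] at hlt
  have hlow := form_lower_bound_D g hg
  have hX : (1 : ℝ) ≤ 1 + ∑ i, (|g i| : ℝ) := by
    have : (0 : ℝ) ≤ ∑ i, (|g i| : ℝ) :=
      Finset.sum_nonneg fun i _ => by exact_mod_cast abs_nonneg (g i)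
    linarith
  have hmono : (1 + ∑ i, (|g i| : ℝ)) ^ 7 ≤ (1 + ∑ i, (|g i| : ℝ)) ^ 8 :=
    pow_le_pow_right₀ hX (by norm_num)
  have := Real.exp_le_exp.mpr (neg_le_neg hmono)
  have hπ : (1 : ℝ) ≤ Real.pi := by have := Real.pi_gt_three; linarith
  have habs := abs_nonneg ((g 0 : ℝ) + g 1 * rhoArc + g 2 * sigmaArc)
  nlinarith

/-- **`zD` lies in the scope of item 33364** — all three hypotheses as TEXT, HYPOTHESIS-FREE. -/
theorem zD_in_scope_33364 :
    LinearIndependent ℚ zD ∧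
    (∀ ω : ℕ, ∃ h : Fin 3 → ℤ, h ≠ 0 ∧ ‖∑ i, (h i : ℂ) * zD i‖ < 1 / (1 + ∑ i, (|h i| : ℝ)) ^ ω) ∧
    (¬ ∀ m : ℕ, ∃ h : Fin 3 → ℤ, h ≠ 0 ∧
      ‖∑ i, (h i : ℂ) * zD i‖ < Real.exp (-((1 + ∑ i, (|h i| : ℝ)) ^ m))) :=
  ⟨linearIndependent_zD, linLiouville_zD, not_hyperLinLiouville_zD⟩

/-- **`zD^π` lies in the scope of item 33364** — HYPOTHESIS-FREE. -/
theorem zDpi_in_scope_33364 :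
    LinearIndependent ℚ zDpi ∧
    (∀ ω : ℕ, ∃ h : Fin 3 → ℤ, h ≠ 0 ∧ ‖∑ i, (h i : ℂ) * zDpi i‖ < 1 / (1 + ∑ i, (|h i| : ℝ)) ^ ω) ∧
    (¬ ∀ m : ℕ, ∃ h : Fin 3 → ℤ, h ≠ 0 ∧
      ‖∑ i, (h i : ℂ) * zDpi i‖ < Real.exp (-((1 + ∑ i, (|h i| : ℝ)) ^ m))) :=
  ⟨linearIndependent_zDpi, linLiouville_zDpi, not_hyperLinLiouville_zDpi⟩

/-- **`SB 3 zD` — HYPOTHESIS-FREE.** -/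
theorem sb_zD : SB 3 zD := sb_twinWall3

/-- **`SB 3 zD^π` — HYPOTHESIS-FREE.** -/
theorem sb_zDpi : SB 3 zDpi := sb_twinWall3_pi

/-- **ITEM 33364 DECIDED AT `zD` — HYPOTHESIS-FREE:** scope (i)–(iii) AND the conclusion. -/
theorem finiteOrderLiouvilleSchanuel_at_zD :
    LinearIndependent ℚ zD ∧ LinLiouville zD ∧ ¬ HyperLinLiouville zD ∧ SB 3 zD :=
  ⟨linearIndependent_zD, linLiouville_zD, not_hyperLinLiouville_zD, sb_zD⟩

/-- **ITEM 33364 DECIDED AT `zD^π` — HYPOTHESIS-FREE.** -/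
theorem finiteOrderLiouvilleSchanuel_at_zDpi :
    LinearIndependent ℚ zDpi ∧ LinLiouville zDpi ∧ ¬ HyperLinLiouville zDpi ∧ SB 3 zDpi :=
  ⟨linearIndependent_zDpi, linLiouville_zDpi, not_hyperLinLiouville_zDpi, sb_zDpi⟩

/-- **THE LIVE ITEM 33364 APPLIED at `zD`** (its text VERBATIM as the hypothesis; the member discharges every binder). -/
theorem item33364_at_zD
    (h33364 : ∀ (n : ℕ) (z : Fin n → ℂ), LinearIndependent ℚ z →
      (∀ ω : ℕ, ∃ h : Fin n → ℤ, h ≠ 0 ∧ ‖∑ i, (h i : ℂ) * z i‖ < 1 / (1 + ∑ i, (|h i| : ℝ)) ^ ω) →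
      (¬ ∀ m : ℕ, ∃ h : Fin n → ℤ, h ≠ 0 ∧
        ‖∑ i, (h i : ℂ) * z i‖ < Real.exp (-((1 + ∑ i, (|h i| : ℝ)) ^ m))) →
      (n : Cardinal) ≤ Algebra.trdeg ℚ
        ↥(IntermediateField.adjoin ℚ (Set.range z ∪ Set.range (Complex.exp ∘ z)))) :
    SB 3 zD := h33364 3 zD linearIndependent_zD linLiouville_zD not_hyperLinLiouville_zD

/-- **THE LIVE ITEM 33364 APPLIED at `zD^π`.** -/
theorem item33364_at_zDpi
    (h33364 : ∀ (n : ℕ) (z : Fin n → ℂ), LinearIndependent ℚ z →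
      (∀ ω : ℕ, ∃ h : Fin n → ℤ, h ≠ 0 ∧ ‖∑ i, (h i : ℂ) * z i‖ < 1 / (1 + ∑ i, (|h i| : ℝ)) ^ ω) →
      (¬ ∀ m : ℕ, ∃ h : Fin n → ℤ, h ≠ 0 ∧
        ‖∑ i, (h i : ℂ) * z i‖ < Real.exp (-((1 + ∑ i, (|h i| : ℝ)) ^ m))) →
      (n : Cardinal) ≤ Algebra.trdeg ℚ
        ↥(IntermediateField.adjoin ℚ (Set.range z ∪ Set.range (Complex.exp ∘ z)))) :
    SB 3 zDpi := h33364 3 zDpi linearIndependent_zDpi linLiouville_zDpi not_hyperLinLiouville_zDpi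

/-- `zD` is ALSO in the scope of item 31077 (`ρ° ∈ span`, Liouville) — bookkeeping, hyp-free. -/
theorem coordLiouvilleSpan_zD : ∃ w ∈ Submodule.span ℚ (Set.range zD), Liouville w.re ∨ Liouville w.im :=
  ⟨zD 1, Submodule.subset_span ⟨1, rfl⟩, Or.inl (by simpa [zD] using liouville_rhoArc)⟩

/-- **ITEM 31077 at `zD`** — bookkeeping; the conclusion is `sb_zD` outright. -/
theorem item31077_at_zD
    (h31077 : ∀ (n : ℕ) (z : Fin n → ℂ), LinearIndependent ℚ z →
      (∃ w ∈ Submodule.span ℚ (Set.range z), Liouville w.re ∨ Liouville w.im) →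
      (n : Cardinal) ≤ Algebra.trdeg ℚ
        ↥(IntermediateField.adjoin ℚ (Set.range z ∪ Set.range (Complex.exp ∘ z)))) :
    SB 3 zD := h31077 3 zD linearIndependent_zD coordLiouvilleSpan_zD

/-- **SHAPE of the twin member**: `zD` is no tuple of the `(1, ℓ₂, ρ)`-walls of record (slot `1` is `ρ° ≠ ℓ₂`), and neither `ρ°`
nor `σ°` is a radix Liouville number `ℓ_b`. -/
theorem zD_shape :
    (∀ ρ : ℝ, zD ≠ ![(1 : ℂ), ((liouvilleNumber 2 : ℝ) : ℂ), ((ρ : ℝ) : ℂ)]) ∧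
    (∀ b : ℕ, 2 ≤ b → rhoArc ≠ liouvilleNumber b) ∧ (∀ b : ℕ, 2 ≤ b → sigmaArc ≠ liouvilleNumber b) ∧
    sigmaArc ≠ rhoArc ∧ Liouville rhoArc ∧ Liouville sigmaArc := by
  refine ⟨fun ρ h => ?_, fun _ hb => rhoArc_ne_liouvilleNumber hb, fun _ hb => sigmaArc_ne_liouvilleNumber hb,
    sigmaArc_ne_rhoArc, liouville_rhoArc, liouville_sigmaArc⟩
  have h1 := congrFun h 1
  have h2 : rhoArc = liouvilleNumber ((2 : ℕ) : ℝ) := by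
    have e : ((rhoArc : ℝ) : ℂ) = ((liouvilleNumber 2 : ℝ) : ℂ) := by simpa [zD] using h1
    exact_mod_cast e
  exact rhoArc_ne_liouvilleNumber (le_refl 2) h2

end TwinMembers

end Summit.Schanuel.Schanuel.Theorems.RootDecomp1KArcCell

end
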